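import Summits.BirchSwinnertonDyer.Rank1Residual.Additive.MazurTateGrowthDichotomyThree
import HarnessLib

/-!
# T-O6-D′ ≡ `ShaGrowthDichotomyThree` — the Ш-GROWTH DICHOTOMY up the cyclotomic `ℤ₃`-tower at an
# additive potentially supersingular `3`, selected by `LocIrr W 3`, and its COMPANION laws
# (o6-r1 GEN 4 FREEZE A-O6-T4 for cc-typer-5 — definitions (i), templates (ii), companion type (iii);
# cell `b2b-bsdres`, lane CLASS-CLOSURE; TYPED, EVIDENCE-LABELLED, NOTHING ASSERTED)

HONEST FRAMING (cell `b2b-bsdres`, verbatim in every file): the goal of the cell is to DELETE the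
COMBINATION-SHAPED residual classes of the Birch–Swinnerton-Dyer formula for ALL analytic-rank `≤ 1`
elliptic curves over `ℚ` — "full BSD formula for every rank `≤ 1` curve in class `C`" assembled
STRICTLY from published theorems — so that the rank-`≤ 1` remainder becomes exactly the
CONSTRUCTION-SHAPED classes, which are TYPED (missing-input `Prop`s), NOT attempted. This is not
"finishing BSD". Lane CLASS-CLOSURE: census output is EVIDENCE / conjecture items with held-out
validation, never a Literature fact; no main conjecture inside any certificate; nothing is booked; no
mark of `RESIDUAL-MAP.md` moves. 0 named Literature facts here; the laws below are `@[conjecture]`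
EVIDENCE items or theorem-candidates (plain `def … : Prop`), and the arithmetic lemmas are proved.

## What is frozen here (o6-r1 GEN 4, `cells/o5o6/TARGETS.md` §O6 (G4-3))

(i) DEFINITIONS. `CycLayerThree n` = the `n`-th layer `ℚ_n = ℚ(ζ_{3^{n+1}})⁺` of the cyclotomic
`ℤ₃`-extension (`n = 1`: `O5.KOne`); `shaExpThree W n := ord₃ #Ш(W/ℚ_n)` (`shaOrder` of the base
change, `Nat.card`, junk `0` when infinite — every law carries `ShaFinite` over every layer as a
binder); `shaIncrThree W n := s_n − s_{n−1}` (`Δs_n`); the irreducible-branch slope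
`shaSlopeIrrThree v := v/12 + 3/8` (`v = v₃(Δ_min)`; `= 5/8, 7/8, 9/8` at `v = 3, 6, 9`), whose two
summands are the Lei–Pollack–Pratap PERIOD slope `v_p(Δ)/12` and the good-supersingular Kurihara–
Perrin-Riou Ш-rate `p/(p² − 1) = 3/8`.

(ii) TEMPLATE (one shape, two branches). EVENTUALLY `Δs_n(W) = M(W)·φ(3^n) + e_{n mod 2}(W)` with
`e₀, e₁ ∈ ℚ` (a `2`-PERIODIC correction: it absorbs the rank, the `2`-periodic Tamagawa number and
Kodaira symbol at the prime above `3`, the torsion, and the period term `P_n = v(u_n) − 3v(u_{n−1})`,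
all MEASURED `2`-periodic from `n = 2`: `P₄ = P₂`, `c_𝔭(ℚ₄) = c_𝔭(ℚ₂)`, `#tors(ℚ₄) = #tors(ℚ₃)`,
`f₄ = f₃`, Kodaira₄ = Kodaira₂ on 184/184 classes, kit j125845), and the DICHOTOMY is on the slope:
`LocIrr W 3 → M(W) = v₃(Δ_min)/12 + 3/8` (so `12·M ∉ ℤ`), `¬LocIrr W 3 → 12·M(W) ∈ ℤ` (and `M(W)` is
then the Mazur–Tate slope `L(W)` of T-O6-D: `dicyclicEffectiveLevel` / `O6.kodairaOffset`, e.g.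
`1/2, 5/6, 1, 7/6, 4/3, 3/2`). Equivalently the second difference `Δs_{n+2} − Δs_n = 16·M·3^{n−1}`:
`= (18 + 4v₃Δ)·3^{n−2}` on the irreducible branch (`30·3^{n−2}` at `v = 3`, `54·3^{n−2}` at `v = 9`),
`∈ 4ℤ·3^{n−2}` on the reducible one.

(iii) COMPANION TYPE. A companion of `W` is a RATIONAL elliptic curve `A/ℚ` with GOOD reduction at
`3` and `A[3] ≅ W[3]` as `Gal(ℚ̄/ℚ)`-modules (`IsCompanionThree`; cc-eng-3 A-ENG3-3 PART A: such an
`A` of level `d ∣ N/27` exists for 1 639 / 2 724 O6-FW rows and for 176 / 296 dicyclic rows; the 1 085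
partner-less O6-FW rows have only a NON-rational weight-`2` newform of level prime to `3`, or Serre
weight `4` — evidence use only, not typed). Two laws: `CompanionTypeIffLocIrrThree` (THEOREM-candidate:
`LocIrr W 3 ↔ 3 ∣ a₃(A)`, i.e. the companion is supersingular at `3` iff `W[3]|G_{ℚ₃}` is irreducible —
Serre's local description; census 1 639 + 8 | 168, 0 exceptions) and `CompanionLambdaShiftThree`
(EVIDENCE conjecture = Pollack–Weston Thm 1 at additive level WITH THE PARTNER EXPLICIT: the signed /
unsigned residual of `λ(θ_k(W))` minus that of `λ(θ_k(A))` is eventually `2`-periodic — predicted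
value the Emerton–Pollack–Weston local sum; first census computation = ASK A-ENG3-4: `θ_k(A)` for the
1 639 + 176 partner classes, levels `9 … 2187`, both engines).

## EVIDENCE of record (o6-r1 GEN 4; shas = sha256[:16]; folder `HOME/b2b-bsdres-o6-r1/gen4/`)
* NUMBER-FIELD SIDE `n ≤ 4` on all 184 potentially supersingular classes `9 ∣ N ≤ 700` (kit j125845,
  `dl_nf.gp`, degree-81 layer; scorer `tower/score_n4.py` → `tower4/n4full_score.txt`; table
  `tower4/shagrowth_184.tsv`, `tower4/nfside_184.tsv`): P1 `v_P(u₄) = ⌊81·v₃Δ/12⌋` (−1 exactly on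
  (4,4)-f4 and (5,7)) 184/184; P2 `f₄ = f₃`, Kodaira₄ = Kodaira₂ 184/184; P3 `c₄ = c₂`, `tors₄ = tors₃`
  184/184; second difference `D₂ := Δs₄ − Δs₂`: `= 54` on 14/14 `LocIrr` `v = 9` rows, `= 30` on 10/13
  `LocIrr` `v = 3` rows, `= 42` on 16/16 `LocIrr` `v = 6` (tame `e = 2`) rows, `= 48·L` on 135/136
  `¬LocIrr` rows — 175/179; the 4 deviations (459a1, 459b1, 459g1: 34; 594c1: 50) equal EXACTLY the
  analytic transient `λ′₄ − λ′₂` of `θ_k` at `k = 2` (the law is EVENTUAL; the `θ`-side constants are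
  verified `2`-periodic from `k = 4`: below).
* ANALYTIC SIDE `k ≤ 6` on all 2 724 O6-FW rows (cc-eng-3 A-ENG3-2 engine-2 tables b12d8feb17750097,
  levels `3⁵, 3⁶, 3⁷`; scorer `tower4/engd2_theta.py` 644aec2902a896eb, STEP-0 `k = 2,3` identical
  2 724/2 724 with f40136cebf7f7bdb; report 5014624a31bd06c0; PRE-REGISTRATION 5a = requests.jsonl
  l.1534): S1 parity (KILLABLE) 0 violations in 23 864 layer-pairs on 2 723 rows, sign clause 0/2 723;
  S2 unit criterion (KILLABLE) 0/54 violators at `2 ≤ k ≤ 5` and `(μ,λ)(θ₆) = (0, q₆)` on 54/54; S3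
  `λ′_{k+2} = λ′_k`: 2 722/2 722 at `k = 4`, 2 552/2 647 at `k = 3`; S4 `μ(θ₆) = 0` on 2 724/2 724
  (`μ(θ₄) > 0` on 2 rows, `μ(θ₅) > 0` on 1).
* C1′ cyclic hold-out FINAL 176/176 curves (`8 000 < N ≤ 20 000`, PRE-REG 4a l.1498): level rule
  175/175, parity 175/175 (killable clauses, 0 violators), stabilised 175/176.
References: [MazurTate1987] Duke 54 §1; [Kurihara2002] Invent. 149 Thm 0.1; [Pollack2003] Duke 118
Prop. 6.9–6.10; [PerrinRiou2003] (Ш-growth at supersingular primes); [PollackWeston2011MT] Duke 156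
Thm 1; [EmertonPollackWeston2006] Invent. 163 Thm 1; [LeiPollackPratap2024] arXiv:2412.16629 Thm 4.7,
§4.2 eq. (perratio), §4.3; [DoyonLei2021] arXiv:2103.06154 §6; [Serre1972] §1.11 Prop. 11–12.

## TYPER PLACEMENT NOTE (cc-typer-5 GEN 3, typer of record O5 §3.5 / O6 §3.4, 2026-08-21)
Landed from o6-r1 GEN 4's frozen sketch `HOME/b2b-bsdres-o6-r1/gen4/ShaGrowthDichotomyThree.lean`
(sha16 07dc3ac4519b7db8) VERBATIM below this note (A-O6-T4; it also discharges my deferral of T-O6-D′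
and re-scopes A-O6-T3 (g) `SelmerCompanionThree` into §3 (iii): the companion is a RATIONAL elliptic
curve, `Δs_n` is `shaOrder` of the base change to `CycLayerThree n`, the per-branch constants are
existential with the dichotomy on `12·M`). DEDUP STANCE: `CompanionLambdaShiftThree` is a SIBLING of
(G3-15) `MazurTateLambdaCongruenceThree branch` (two ADDITIVE curves) and of o5-r1's T11
`O5.CongruenceTransportLawThree` (O5b pairs) — same mechanism (EPW λ-transport along a mod-`3`
congruence), different binders (here the partner `A` is GOOD at `3`, template `kuriharaQ` / `0`), so it
is NOT merged today; a future node 'λ-transport across a mod-3 congruence for arbitrary local types at 3,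
template by local type' would subsume all three and is typed when somebody states it. B-10 (b) (cc-lead):
no declaration in this file, nor in any O5/O6 node of record, takes a NON-rational weight-2 newform as a
binder — the 1 085 partner-less O6-FW rows are evidence population only (concurring with o6-r1 GEN 4's NO).
Audit marks `vendored-fact` on `IsCompanionThree` (a predicate with a body) and `CompanionTypeIffLocIrrThree`
(a THEOREM-CANDIDATE target, Serre §1.11 — to be PROVED, not assumed — and PROVED since 2026-08-21:
`companionTypeIffLocIrrThree_holds`, x11b3-p4 GEN 10 p305995; no chain consumes it as a hypothesis)
and `orphan` on the proved arithmetic are the expected shape of a typed-target file.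

## ERRATUM (o6-r1 GEN 5, 2026-08-21; recorded by cc-typer-5 GEN 4, ASK A-O6-T5 (b) — DOC-ONLY, no
## declaration or statement changed)
THE IRREDUCIBLE CLAUSE OF `ShaGrowthDichotomyThree` IS WITHDRAWN BY ITS AUTHOR. The constant
`shaSlopeIrrThree v = v/12 + 3/8` is the MAZUR–TATE slope of the residually irreducible rows (the
slope of T-O6-D `MazurTateGrowthDichotomyThree`), NOT the Ш-slope: the gen-3/4 bookkeeping booked the
period increment of BSD₃(W/ℚ_n) as `v(u_n) − 3·v(u_{n−1})` (an `O(1)` quantity) where the correct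
increment is `v(u_n) − v(u_{n−1}) = (v₃Δ/12)·φ(3^n) + O(1)` (layer period `Ω(W/ℚ)^{3^n}·3^{v(u_n)}`,
`12·v(u_n) = 3^n·v₃(Δ_min) − v(Δ_min(W/ℚ_n))`; Lei–Pollack–Pratap arXiv:2412.16629 Lemma 3.11 and the
proof of Thm 4.7). Hence `M_Ш = M_MT − v₃Δ/12`, and on the irreducible branch the Ш-rate is the
UNIVERSAL `3/8` (o6-r1 GEN 5 re-score: second difference `Δs₄ − Δs₂ = 18` on 40/43 raw, 43/43 modulo
the named `k = 2` transient, across `v₃Δ ∈ {3, 6, 9}`; the 11 rank-0 unit rows give `Δs_n = q_n`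
exactly). The "EVIDENCE of record" figures above for `D₂ = 54 / 30 / 42` on `LocIrr` rows are the
v1-bookkeeping numbers and are superseded by the re-score. The reducible clause (`12·M ∈ ℤ`),
`IsCompanionThree`, `CompanionTypeIffLocIrrThree`, `CompanionLambdaShiftThree` (a statement about
Mazur–Tate elements, untouched by the period term) and all proved arithmetic STAND as landed. THE
CORRECTED NODE IS `ShaGrowthRateDichotomyThree` (T-O6-D′ v2, irreducible clause `M = shaRateIrrThree =
3/8`; sibling module `Additive.ShaGrowthRateDichotomyThree`, which imports this one and also carries
`CompanionShaGrowthThree` and `shaSlopeIrrThree_eq_mtSlope : shaSlopeIrrThree v = v/12 + shaRateIrrThree`).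
Cite `ShaGrowthRateDichotomyThree`, not this node's irreducible clause. Supersede, never re-word in place:
the statements below are byte-identical to p259222. Records: o6-r1 `gen5/O6-GEN5.md` §8, `cells/o5o6/
TARGETS.md` (G5-1)/(G5-7), `class-closure/O6/STATEMENT.md` §6, `class-closure/O6/TYPED.md` §8.

## ERRATUM 2 (o6-r1 GEN 6 V6-C, kit j129939, 2026-08-21; recorded by cc-typer-5 GEN 4, ASK A-O6-T6 (b) —
## DOC-ONLY, no declaration or statement changed)
`CompanionLambdaShiftThree`: the PREDICTED value 's₀ = s₁ = EPW sum' in its docstring is REFUTED as an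
exact law (1 380/2 890 decisive cells); measured `s_{k mod 2} = EPW + ρ_{k−1}(A) − ρ_k(A)`; the typed
2-periodic statement STANDS (3 151/3 151 at `k = 4, 6`); the exact single-constant (shifted) form is the
sibling node `CompanionLambdaShiftThreePW` (module `Additive.CompanionLambdaShiftThreePW`, o6-r1 GEN 6
sha16 f21b9227c4c178b3). Records: o6-r1 `gen6/O6-GEN6.md`, `class-closure/O6/TYPED.md` §8.
-/

set_option autoImplicit false

noncomputable section

open scoped Classical MatrixGroups ModularForm NumberField

open CongruenceSubgroup Polynomial WeierstrassCurve NumberField Literature.NumberTheory.EllipticCurves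
  Literature.NumberTheory.EllipticCurves.ModularForms
  Literature.NumberTheory.EllipticCurves.Rank1Residual
  Literature.NumberTheory.EllipticCurves.Rank1Residual.Typed
  Summit.BirchSwinnertonDyer.Rank1Residual.X1.MuLambda

namespace Summit.BirchSwinnertonDyer.Rank1Residual.Additive

/-! ## §1 (i) Definitions: layers, Ш-exponents, increments, the irreducible slope -/

/-- The `n`-th layer `ℚ_n = ℚ(ζ_{3^{n+1}})⁺` of the cyclotomic `ℤ₃`-extension of `ℚ` (degree `3^n`;
`ℚ₀ = ℚ`, `ℚ₁ = ℚ(ζ₉)⁺ = O5.KOne`), as the maximal real subfield of `ℚ(ζ_{3^{n+1}})`. [folklore] -/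
abbrev CycLayerThree (n : ℕ) : Type := maximalRealSubfield (CyclotomicField (3 ^ (n + 1)) ℚ)

/-- Layer one is o5-r1's `KOne = ℚ(ζ₉)⁺` (definitionally). [folklore] -/
theorem cycLayerThree_one : CycLayerThree 1 = O5.KOne := rfl

/-- `s_n(W) := ord₃ #Ш(W/ℚ_n)` — the `3`-adic valuation of `shaOrder` of the base change to the `n`-th
layer (`Nat.card`, junk `0` if `Ш` is infinite; the laws carry `ShaFinite` as a binder). [folklore] -/
def shaExpThree (W : WeierstrassCurve ℚ) (n : ℕ) : ℕ :=
  padicValNat 3 (W.baseChange (CycLayerThree n)).shaOrder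

/-- `Δs_n(W) := s_n(W) − s_{n−1}(W)` (for `n ≥ 1`; at `n = 0` it is `0`). [folklore] -/
def shaIncrThree (W : WeierstrassCurve ℚ) (n : ℕ) : ℤ :=
  (shaExpThree W n : ℤ) - (shaExpThree W (n - 1) : ℤ)

/-- ERRATUM (o6-r1 GEN 5): this constant is the MAZUR–TATE slope of the residually irreducible rows,
NOT the Ш-slope — the Ш-rate is `shaRateIrrThree = 3/8` (universal); see
`shaSlopeIrrThree_eq_mtSlope : shaSlopeIrrThree v = v/12 + shaRateIrrThree` and cite
`ShaGrowthRateDichotomyThree` (module `Additive.ShaGrowthRateDichotomyThree`). Definition unchanged.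
ORIGINAL DOCSTRING: The IRREDUCIBLE-branch Ш-growth slope `M = v/12 + 3/8` (`v = v₃(Δ_min)`): the
Lei–Pollack–Pratap period slope `v_p(Δ)/12` plus the good-supersingular Ш-rate `p/(p² − 1) = 3/8` of
Kurihara / Perrin-Riou (`q_n/φ(pⁿ) → p/(p²−1)`). [cite: LeiPollackPratap2024, §4.2 eq. (perratio)]
[cite: Kurihara2002, Thm. 0.1] -/
def shaSlopeIrrThree (v : ℤ) : ℚ := (v : ℚ) / 12 + 3 / 8

/-- Values: `M(3) = 5/8` (wild II / tame III), `M(6) = 7/8` (tame `e = 2`), `M(9) = 9/8` (wild IV* /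
tame III*). [folklore] -/
theorem shaSlopeIrrThree_values :
    shaSlopeIrrThree 3 = 5 / 8 ∧ shaSlopeIrrThree 6 = 7 / 8 ∧ shaSlopeIrrThree 9 = 9 / 8 := by
  refine ⟨?_, ?_, ?_⟩ <;> norm_num [shaSlopeIrrThree]

/-- The second-difference constant of the irreducible branch: `48·M(v) = 18 + 4v` (`30, 42, 54` at
`v = 3, 6, 9`). [folklore] -/
theorem fortyEight_mul_shaSlopeIrrThree (v : ℤ) : 48 * shaSlopeIrrThree v = 18 + 4 * (v : ℚ) := by
  unfold shaSlopeIrrThree; ring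

/-- `12·M(v)` is never an integer on the irreducible branch (`12M = v + 9/2`), whereas the reducible
slopes `L ∈ {1/2, 5/6, 1, 7/6, 4/3, 3/2}` have `12L ∈ ℤ` — the dichotomy is visible on `12M`.
[folklore] -/
theorem twelve_mul_shaSlopeIrrThree_ne_int (v z : ℤ) : 12 * shaSlopeIrrThree v ≠ (z : ℚ) := by
  unfold shaSlopeIrrThree
  intro h
  have h2 : (2 : ℚ) * z = 2 * v + 9 := by linarith
  have h3 : (2 * z : ℤ) = 2 * v + 9 := by exact_mod_cast h2
  omega

/-- `φ(3^{n+1}) = 2·3^n`. [folklore] -/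
theorem totient_three_pow_succ (n : ℕ) : Nat.totient (3 ^ (n + 1)) = 2 * 3 ^ n := by
  rw [Nat.totient_prime_pow_succ Nat.prime_three]; ring

/-! ## §2 (ii) T-O6-D′ — the Ш-growth dichotomy (EVIDENCE conjecture) -/

/-- ERRATUM (o6-r1 GEN 5): irreducible clause WITHDRAWN — `shaSlopeIrrThree` is the Mazur–Tate
slope; the Ш-rate is `shaRateIrrThree = 3/8`; cite `ShaGrowthRateDichotomyThree` (T-O6-D′ v2, module
`Additive.ShaGrowthRateDichotomyThree`). The reducible clause `12·M ∈ ℤ` stands. Statement unchanged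
(supersede, never re-word in place). ORIGINAL DOCSTRING:
**T-O6-D′ ≡ `ShaGrowthDichotomyThree` (CONJECTURE; EVIDENCE-labelled; o6-r1 GEN 4 FREEZE (ii)).**
For `W/ℚ` additive at `3` with `f₃ ≥ 2` and potentially SUPERSINGULAR reduction (`v₃(j) > 0` or
`j = 0`), assuming `Ш(W/ℚ_n)` finite at every layer: there are `M, e₀, e₁ ∈ ℚ` and `n₀` with
`Δs_n(W) = M·φ(3^n) + e_{n mod 2}` for all `n ≥ n₀`, where `M = v₃(Δ_min)/12 + 3/8` if `W[3]|G_{ℚ₃}`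
is IRREDUCIBLE and `12·M ∈ ℤ` if it is REDUCIBLE. This is T-O6-D (`MazurTateGrowthDichotomyThree`)
read through BSD₃(W/ℚ_n) and the measured `2`-periodicity of the number-field side; it is stated
WITHOUT Mazur–Tate elements so that a signed-Selmer theory at additive `3` has a stand-alone target.
EVIDENCE: module docstring (184 classes × `n ≤ 4`: 175/179 second differences, the 4 deviations =
the `k = 2` analytic transient; 2 724 O6-FW rows × `k ≤ 6` on the analytic side). KILL: one class with
`9 ∣ N` whose `Δs₄ − Δs₂ − (λ′₄ − λ′₂)` differs from `48·M` (instrument: `dl_nf.gp` + ENG-D), or — the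
eventual statement itself — any class where `Δs_{n+2} − Δs_n ≠ 16·M·3^{n−1}` at two consecutive
`n ≥ 4`. [cite: LeiPollackPratap2024, Thm 4.7 and §4.3] [cite: PollackWeston2011MT, Thm. 1]
[cite: Kurihara2002, Thm. 0.1] [cite: DoyonLei2021, §6] -/
@[conjecture] def ShaGrowthDichotomyThree : Prop :=
  ∀ (W : WeierstrassCurve ℚ) [W.IsElliptic] [W.IsGloballyMinimal],
    Addv W 3 → 2 ≤ condExp W 3 → (0 < padicValRat 3 W.j ∨ W.j = 0) →
    (∀ n : ℕ, (W.baseChange (CycLayerThree n)).ShaFinite) →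
    ∃ (M e₀ e₁ : ℚ) (n₀ : ℕ),
      (LocIrr W 3 → M = shaSlopeIrrThree (padicValInt 3 W.minimalDiscriminantInt)) ∧
      (¬ LocIrr W 3 → ∃ z : ℤ, 12 * M = z) ∧
      ∀ n : ℕ, n₀ ≤ n →
        (shaIncrThree W n : ℚ) = M * (Nat.totient (3 ^ n) : ℚ) + (if n % 2 = 0 then e₀ else e₁)

/-- Under T-O6-D′ the SECOND DIFFERENCE is geometric: `Δs_{n+3} − Δs_{n+1} = 16·M·3^n` for
`n + 1 ≥ n₀` (the `2`-periodic correction cancels). [folklore] -/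
theorem ShaGrowthDichotomyThree.secondDiff (h : ShaGrowthDichotomyThree)
    (W : WeierstrassCurve ℚ) [W.IsElliptic] [W.IsGloballyMinimal]
    (hadd : Addv W 3) (hf : 2 ≤ condExp W 3) (hss : 0 < padicValRat 3 W.j ∨ W.j = 0)
    (hfin : ∀ n : ℕ, (W.baseChange (CycLayerThree n)).ShaFinite) :
    ∃ (M : ℚ) (n₀ : ℕ), (LocIrr W 3 → M = shaSlopeIrrThree (padicValInt 3 W.minimalDiscriminantInt)) ∧
      (¬ LocIrr W 3 → ∃ z : ℤ, 12 * M = z) ∧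
      ∀ n : ℕ, n₀ ≤ n + 1 →
        (shaIncrThree W (n + 3) : ℚ) - shaIncrThree W (n + 1) = 16 * M * 3 ^ n := by
  obtain ⟨M, e₀, e₁, n₀, hirr, hred, hlaw⟩ := h W hadd hf hss hfin
  refine ⟨M, n₀, hirr, hred, fun n hn ↦ ?_⟩
  have h1 := hlaw (n + 1) hn
  have h3 := hlaw (n + 3) (by omega)
  have hpar : (n + 3) % 2 = (n + 1) % 2 := by omega
  rw [h1, h3, hpar, show n + 3 = (n + 2) + 1 from rfl, totient_three_pow_succ, totient_three_pow_succ]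
  push_cast
  ring

/-- ERRATUM (o6-r1 GEN 5): irreducible clause WITHDRAWN — `shaSlopeIrrThree` is the Mazur–Tate
slope; the Ш-rate is `shaRateIrrThree = 3/8`, so the corrected irreducible second difference is the
UNIVERSAL `2·3^{n+1}` (`ShaGrowthRateDichotomyThree.secondDiff_irr`); cite `ShaGrowthRateDichotomyThree`.
This lemma remains a correct CONSEQUENCE OF v1 as stated (statement unchanged). ORIGINAL DOCSTRING:
On the IRREDUCIBLE branch the second difference is `(18 + 4·v₃Δ)·3^n / 3` … stated cleanly one
layer up: `Δs_{n+3} − Δs_{n+1} = (6 + 4v/3)·3^n`, i.e. `48M·3^{n−1}` with `48M = 18 + 4v`; at `v = 9`: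
`18·3^n`, at `v = 3`: `10·3^n`. [folklore] -/
theorem ShaGrowthDichotomyThree.secondDiff_irr (h : ShaGrowthDichotomyThree)
    (W : WeierstrassCurve ℚ) [W.IsElliptic] [W.IsGloballyMinimal]
    (hadd : Addv W 3) (hf : 2 ≤ condExp W 3) (hss : 0 < padicValRat 3 W.j ∨ W.j = 0)
    (hfin : ∀ n : ℕ, (W.baseChange (CycLayerThree n)).ShaFinite) (hirr : LocIrr W 3) :
    ∃ n₀ : ℕ, ∀ n : ℕ, n₀ ≤ n + 1 →
      3 * ((shaIncrThree W (n + 3) : ℚ) - shaIncrThree W (n + 1)) =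
        (18 + 4 * ((padicValInt 3 W.minimalDiscriminantInt : ℤ) : ℚ)) * 3 ^ n := by
  obtain ⟨M, n₀, hM, -, hlaw⟩ := h.secondDiff W hadd hf hss hfin
  refine ⟨n₀, fun n hn ↦ ?_⟩
  rw [hlaw n hn, hM hirr]
  unfold shaSlopeIrrThree
  ring

/-! ## §3 (iii) Companions: type decides the branch (theorem-candidate); λ-shift law (EVIDENCE) -/

/-- **Companion** of `W` at `3`: a rational elliptic curve `A` with GOOD reduction at `3` and a
`Gal(ℚ̄/ℚ)`-equivariant isomorphism `A[3] ≅ W[3]` (the cell's `p`-congruence phrasing, as in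
`GoodOrdinaryPartnerSource`). cc-eng-3 A-ENG3-3 PART A (trace-congruence screen at all `ℓ ≤ 300`,
`ℓ ∤ 3N`, + 24 large primes; for irreducible `W[3]` a full trace congruence gives the isomorphism by
Brauer–Nesbitt + Chebotarev): a companion of level `d ∣ N/27` exists on 1 639 / 2 724 O6-FW rows.
[folklore] -/
def IsCompanionThree (W A : WeierstrassCurve ℚ) [W.IsElliptic] [A.IsElliptic] : Prop :=
  A.HasGoodReductionAtPrime 3 ∧
    ∃ e : geomTorsion A (3 : ℤ) ≃+ geomTorsion W (3 : ℤ),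
      ∀ (σ : Field.absoluteGaloisGroup ℚ) (P : geomTorsion A (3 : ℤ)), e (σ • P) = σ • e P

/-- **The companion's type at `3` decides the branch (THEOREM-CANDIDATE; nothing asserted).** If `A` is
a companion of `W` then `W[3]|G_{ℚ₃}` is irreducible iff `A` is SUPERSINGULAR at `3` (`3 ∣ a₃(A)`):
`W[3] ≅ A[3]` restricts to `G_{ℚ₃}`; at a good ordinary prime `A[p]|G_{ℚ_p}` has the canonical line
(reducible), at a good supersingular prime inertia acts through the fundamental character of level `2`
(irreducible) — Serre. CENSUS (EVIDENCE): every rational `M`-type partner of the 2 724 O6-FW rows (all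
`LocIrr`) is good supersingular (1 639 / 1 639 rows with a partner, 0 ordinary); dicyclic rows:
supersingular partners exactly on the 8 `LocIrr` rows, ordinary on 168 `¬LocIrr` rows (cc-eng-3
A-ENG3-3 PART A, 662e19f824a95396 / 88206fbfe2d9f053); cc-eng-1 `locirr3` column: good-ss ⇒
irreducible 2 898/2 898, good-ordinary ⇒ reducible 9 127/9 127 classes. **PROVED 2026-08-21 (cc-typer-5 GEN 10
restamp): `companionTypeIffLocIrrThree_holds : CompanionTypeIffLocIrrThree`** (cross-cell pool hand x11b3-p4 GEN 10,
`Additive/CompanionTypeIffLocIrrThreeHolds.lean` p305995 5b6727a19496): (S1) `LocIrr` transports along ANY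
`Γ_ℚ`-equivariant `A[p] ≃+ W[p]`, any prime `p` (`locIrr_iff_of_equivariant`, via `torsionTransferEquiv` /
`absGaloisRestrict ℚ ℚ_[p]`); (S2) at a GOOD prime `3`, `LocIrr A 3 ↔ 3 ∣ a₃(A)`
(`locIrr_three_iff_dvd_frobeniusTrace_of_hasGoodReductionAtPrime`: L-O56-sel valuation criterion + `a₃ ≡ b₂ (mod 3)`
from the Hasse point count + the integer lemma `3 ∣ b₂ ↔ criterion` when `3 ∤ Δ`) — so the RHS "`3 ∣ a₃(A)`" is the
right supersingularity predicate at `p = 3` (`a₃ ∈ {0, ±3}` occur). Statement byte-identical (untagged THEOREM-target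
as typed in GEN 3); census numbers stay EVIDENCE; nothing booked; no mark. [cite: Serre1972, §1.11 Prop. 12] -/
def CompanionTypeIffLocIrrThree : Prop :=
  ∀ (W A : WeierstrassCurve ℚ) [W.IsElliptic] [W.IsGloballyMinimal] [A.IsElliptic]
    [A.IsGloballyMinimal], IsCompanionThree W A → (LocIrr W 3 ↔ (3 : ℤ) ∣ A.frobeniusTrace 3)

/-- The Mazur–Tate TEMPLATE of `W` at layer `k` on the two branches, over a slope `L` used only on the
reducible branch: `signedBase v k` (`= q_{k+1}·[v = 9]`-shape, S1–S4) if `LocIrr W 3`, else `L·φ(3^k)`.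
[folklore] -/
def mtTemplateThree (W : WeierstrassCurve ℚ) [W.IsElliptic] [W.IsGloballyMinimal] (L : ℚ) (k : ℕ) : ℚ :=
  if LocIrr W 3 then (signedBase (padicValInt 3 W.minimalDiscriminantInt) k : ℚ)
  else L * (Nat.totient (3 ^ k) : ℚ)

/-- The Mazur–Tate TEMPLATE of a GOOD companion `A` at layer `k`: Kurihara's `q_{k−1}`
(`O5.kuriharaQ k` in the tree's indexing: `0, 0, 2, 6, 20, 60, 182`) if `A` is supersingular at `3`,
`0` if ordinary (then `λ(θ_k(A))` is eventually the constant `λ(L₃(A))` when `μ = 0`).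
[cite: Kurihara2002, Thm. 0.1] [cite: Pollack2003, Prop. 6.9–6.10] -/
def companionTemplateThree (A : WeierstrassCurve ℚ) [A.IsGloballyMinimal] (k : ℕ) : ℚ :=
  if (3 : ℤ) ∣ A.frobeniusTrace 3 then (O5.kuriharaQ k : ℚ) else 0

/-- ERRATUM (o6-r1 GEN 6 V6-C, kit j129939; recorded by cc-typer-5 GEN 4, ASK A-O6-T6 (b) — DOC-ONLY,
statement unchanged): the PREDICTED value 's₀ = s₁ = EPW sum' below is REFUTED as an exact law
(1 380/2 890 decisive cells); measured s_{k mod 2} = EPW + ρ_{k−1}(A) − ρ_k(A); the typed 2-periodic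
statement STANDS (3 151/3 151 at k = 4, 6); exact single-constant (shifted) form:
`CompanionLambdaShiftThreePW` (module `Additive.CompanionLambdaShiftThreePW`). ORIGINAL DOCSTRING:
**`CompanionLambdaShiftThree` (CONJECTURE; EVIDENCE-labelled; o6-r1 GEN 4 FREEZE (iii)) — the
Pollack–Weston Theorem-1 SHAPE at additive level with the partner explicit.** For `W` additive at `3`
(`f₃ ≥ 2`, potentially supersingular, `W[3]` irreducible) and a companion `A` (good at `3`,
`A[3] ≅ W[3]`): there are `L ∈ ℚ` with `12L ∈ ℤ`, constants `s₀, s₁ ∈ ℚ` and `k₀` such that at every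
layer `k ≥ k₀` where both `θ_k(W)` and `θ_k(A)` have `μ = 0`,
`[λ(θ_k(W)) − template_W(k)] − [λ(θ_k(A)) − template_A(k)] = s_{k mod 2}` — the residual constants of
`W` are those of its companion up to a `2`-periodic shift (PREDICTED value, not typed: the Emerton–
Pollack–Weston local sum `Σ_{ℓ ≠ 3, ℓ ∣ N_W N_A} (e_ℓ(A) − e_ℓ(W))` at its stable layer value, with
`s₀ = s₁` and `= λ`-shift on the reducible/ordinary branch). EVIDENCE so far: classes of 17a1
(`LocIrr`: 153d1, 459d1, 459e1, 459h1 `λ = q_k` vs `λ(θ_k(17a1)) = q_{k−1}`, shift `0`, `k ≤ 6`, kit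
j125943) and the (2,6) twist class; EPW at additive level within O6 2 737/2 741 layer-pairs
((G3-15), `MazurTateLambdaCongruenceThree`). FIRST CENSUS COMPUTATION (ASK A-ENG3-4 → cc-eng-3):
`θ_k(A)`, `k ≤ 6`, for the 1 639 O6-FW + 176 dicyclic companion classes (levels `≤ N/27`, seconds
each), scored by `tower4/engd2_theta.py` + `tower/epw_pairs.py` logic; KILL: a (row, companion) pair
with both `μ = 0`, unsaturated `λ`, and a residual difference that is not `2`-periodic from `k = 4`, or
differs from the EPW sum beyond the double-eigenvalue case. [cite: PollackWeston2011MT, Thm. 1]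
[cite: EmertonPollackWeston2006, Thm. 1] -/
@[conjecture] def CompanionLambdaShiftThree : Prop :=
  ∀ (W A : WeierstrassCurve ℚ) [W.IsElliptic] [W.IsGloballyMinimal] [A.IsElliptic]
    [A.IsGloballyMinimal] [NeZero (W.conductorNorm ℤ)] [NeZero (A.conductorNorm ℤ)]
    (fW : CuspForm (Gamma0 (W.conductorNorm ℤ)) 2) (fA : CuspForm (Gamma0 (A.conductorNorm ℤ)) 2),
    IsNewformOf W fW → IsNewformOf A fA → Addv W 3 → 2 ≤ condExp W 3 →
    (0 < padicValRat 3 W.j ∨ W.j = 0) → W.HasIrreducibleModPGaloisRep 3 → IsCompanionThree W A →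
    ∃ (L s₀ s₁ : ℚ) (k₀ : ℕ), (∃ z : ℤ, 12 * L = z) ∧
      ∀ (k mW mA : ℕ) (ΘW ΘA : IwasawaAlgebra 3), k₀ ≤ k →
        O5.IsScaledMazurTateLift fW k mW ΘW → ΘW ≠ 0 → mu ΘW = mW →
        O5.IsScaledMazurTateLift fA k mA ΘA → ΘA ≠ 0 → mu ΘA = mA →
        ((lam ΘW : ℚ) - mtTemplateThree W L k) - ((lam ΘA : ℚ) - companionTemplateThree A k) =
          if k % 2 = 0 then s₀ else s₁

/-! ## §4 Kernel sanity (values PROVED; nothing conjectural) -/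

/-- The irreducible second-difference constants and the tree's signed base agree:
`signedBase 9 (k+2) − signedBase 9 k = 18·3^{k−1}` and `signedBase 3 (k+2) − signedBase 3 k = 10·3^{k−1}`
at `k = 2, 3, 4` (= `54, 162, 486` and `30, 90, 270`), matching `48·M = 54` / `30` per `3^{k−2}`.
[folklore] -/
theorem signedBase_secondDiff_values :
    signedBase 9 4 - signedBase 9 2 = 54 ∧ signedBase 9 5 - signedBase 9 3 = 162 ∧
      signedBase 9 6 - signedBase 9 4 = 486 ∧ signedBase 3 4 - signedBase 3 2 = 30 ∧
      signedBase 3 5 - signedBase 3 3 = 90 ∧ signedBase 3 6 - signedBase 3 4 = 270 := by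
  simp [signedBase, O5.kuriharaQ]

/-- The companion template is one layer BEHIND the additive signed base at `v = 9`:
`signedBase 9 k − kuriharaQ k = 2·3^{k−1}… ` concretely `(6,20,60,182) − (2,6,20,60) = (4,14,40,122)`
= `φ(3^k)·9/8 − …` — the PW shift `pⁿ − pⁿ⁻¹ + q_{n−1}` read at `p = 3`: values at `k = 2..5`.
[folklore] -/
theorem signedBase_sub_kuriharaQ_values :
    signedBase 9 2 - O5.kuriharaQ 2 = 4 ∧ signedBase 9 3 - O5.kuriharaQ 3 = 14 ∧
      signedBase 9 4 - O5.kuriharaQ 4 = 40 ∧ signedBase 9 5 - O5.kuriharaQ 5 = 122 := by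
  simp [signedBase, O5.kuriharaQ]

end Summit.BirchSwinnertonDyer.Rank1Residual.Additive

end
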